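import Summits.BirchSwinnertonDyer.Rank1Residual.X5.TwoAdicInstancesT42AnchorsS2
import Summits.BirchSwinnertonDyer.Rank1Residual.X5.TwoAdicInstancesMultAnchorsS
import Summits.BirchSwinnertonDyer.Rank1Residual.X5.TwoAdicInstances144027d
import Summits.BirchSwinnertonDyer.Rank1Residual.X5.TwoAdicInstancesToolkitC
import Summits.BirchSwinnertonDyer.Rank1Residual.X5.TwoAdicInstancesToolkitD
import Summits.BirchSwinnertonDyer.BirchSwinnertonDyer.Theorems.Rank2ObservatoryRootNumberCert3
import HarnessLib

/-!
# X5 at `p = 2` (cell `bsd-2adic`, seat `bsd-2adic-t42`, GEN 7): SPLIT ANCHORS `90b2`, `42a4` for DOOR (34-GV-mult) — curve data only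

HONEST FRAMING (cell `bsd-2adic`, run/shared/lean/pub/bsd-2adic/, HUMAN RULINGS D-0036 / D-0054): research route; NO door theorem,
nothing displayed, nothing booked; BSD is not proved by any of this. PARTITION: X5@2 multiplicative (K4ᵐ, RESIDUAL-MAP B1·O1;
tranche 1 of the GV-mult habitat) × p = 2 — types-the-object-of (anchor curves for the congruence transport; closes none).
WHAT: the split multiplicative ANCHORS (`2 ∥ N`, `r = 0`, exactly one rational `2`-torsion point, of Greenberg type A or B) that the
tranche-1 classes of HOME/t42/DESIGN-T42-ADDENDUM-8.md need and that are NOT in the mult lane's anchors files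
`X5/TwoAdicInstancesMultAnchors{A,B,C,S}.lean` (one writer per object: those files are imported elsewhere, never edited; planner word
2026-08-27T03:25:10Z (A) «if a class needs a NEW anchor, add it in a t42 anchors file»). Per anchor, DECIDED BY THE KERNEL: minimality,
ellipticity, SPLIT multiplicative reduction at `2`, the conductor (squarefree: coprimality; additive `3`: Rizzo's Table II in the kernel;
additive `ℓ ≥ 5`: `f = 2`), the unique rational `2`-torsion point and its Greenberg type, `2 ∣ #Ẽ(𝔽_ℓ)` at good odd `ℓ`. The anchors'
λ-invariant enters the doors ONLY through the displayed certificate binders `hlanA : λ_an(A) = 1`, `hμanA` of the class files (rows: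
engine-1 kit j268238 (GVM-cert.gp @e1208179ed243b20 verbatim: LAW PASS, MU0 YES) + engine-2 kit j268244 (afe2_engine.gp v2 @9fa2375668e227f7: verdict OK, STABLE) — two-engine, t42 GEN 7) — EVIDENCE, never facts. Emitter: HOME/t42/gen/gen_anchorsfile.py + memberdata.py (port of the mult lane's genlaw5.py member block).
WHAT THIS IS NOT: not a door, not a certificate, not a discharge of anything.

References: [SilvermanAEC2009] VII.1, VII.3.1, VII.5.1, III.1–III.2; [Silverman1994] IV.10.2; [GreenbergLNM1716] §5, Prop. 5.14;
[GreenbergVatsal2000] p. 4 (anchors); [CremonaAlgorithms1997] Table 1 (90b2, 42a4); [Rizzo2003] Table II.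
-/

set_option autoImplicit false

open IsDedekindDomain WeierstrassCurve Literature.NumberTheory.EllipticCurves
  Literature.NumberTheory.EllipticCurves.ModularForms
  Literature.NumberTheory.EllipticCurves.Rank1Residual
  Literature.NumberTheory.EllipticCurves.Rank1Residual.Typed
  Literature.NumberTheory.EllipticCurves.Greenberg1999
  Literature.NumberTheory.EllipticCurves.PolyCert
  Literature.NumberTheory.EllipticCurves.Rank1Residual.X11RankOneCertificates
  Summit.BirchSwinnertonDyer.Rank1Residual.X1.MuPart
  Summit.BirchSwinnertonDyer.Rank1Residual.X1.ParitySqueeze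
  Summit.BirchSwinnertonDyer.Rank1Residual.X5.O1
  Summit.BirchSwinnertonDyer.BirchSwinnertonDyer.Rank2Observatory.RootNumber

open CongruenceSubgroup
open scoped MatrixGroups ModularForm

namespace Summit.BirchSwinnertonDyer.Rank1Residual.X5.Instances

/-! ## Anchor `90b2` (`N = 90`, split at `2`, type A, `x(P) = 27/4`) -/

/-- Cremona `90b2` = `[1, -1, 1, -128, 587]` (integer model). [cite: CremonaAlgorithms1997, Table 1] -/
abbrev M90b2 : WeierstrassCurve ℤ := ⟨1, -1, 1, -128, 587⟩
/-- `90b2 / ℚ`. [cite: CremonaAlgorithms1997, Table 1] -/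
abbrev c90b2 : WeierstrassCurve ℚ := M90b2.baseChange ℚ
/-- `Δ(90b2) = 2^3·3^3·5^2`. [cite: CremonaAlgorithms1997, Table 1] -/
theorem M90b2_Δ : M90b2.Δ = 5400 := by decide
/-- `c₄(90b2)` (`|c₄| = 3^3·227`). [cite: CremonaAlgorithms1997, Table 1] -/
theorem M90b2_c₄ : M90b2.c₄ = 6129 := by decide
/-- `c₆(90b2)`. [cite: CremonaAlgorithms1997, Table 1] -/
theorem M90b2_c₆ : M90b2.c₆ = -479817 := by decide
/-- **Rizzo's Table II at `90b2`, evaluated in the kernel on the integer invariants** (`3^3 ∥ c₄`, `3^3 ∥ c₆`, `3^3 ∥ Δ`):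
`v₃(N) = 2` (additive, tamely ramified). [cite: Rizzo2003, Table II (p. 4), column v(N)] -/
theorem condExp_90b2 :
    Rizzo.condExpOfInvariants (M90b2.c₄ : ℚ) (M90b2.c₆ : ℚ) (M90b2.Δ : ℚ) = 2 := by
  rw [M90b2_c₄, M90b2_c₆, M90b2_Δ,
    condExpOfInvariants_intCast _ _ _ 3 3 3 (Or.inr (by decide)) (Or.inr (by decide)) (by decide)]
  decide
/-- `90b2` is an elliptic curve. [cite: CremonaAlgorithms1997, Table 1] -/
instance c90b2_isElliptic : c90b2.IsElliptic := by
  rw [WeierstrassCurve.isElliptic_iff, baseChange_int_Δ, M90b2_Δ]; norm_num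
/-- Cremona's model `90b2` is globally minimal (integer criterion at the primes of `gcd(Δ, c₄) = 27`). [cite: SilvermanAEC2009, VII.1 Remark 1.1] -/
instance c90b2_isGloballyMinimal : c90b2.IsGloballyMinimal := by
  rw [c90b2, baseChange_int_eq]
  refine isGloballyMinimal_of_int_criterion 1 (-1) 1 (-128) 587 (int_criterion_of_primeFactors_gcd (by decide) ?_)
  have hg : (Int.gcd (discOf [1, -1, 1, -128, 587]) (c4Of [1, -1, 1, -128, 587])).primeFactors = {3} := by
    rw [show Int.gcd (discOf [1, -1, 1, -128, 587]) (c4Of [1, -1, 1, -128, 587]) = 27 by decide]; simp [Nat.primeFactors]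
  rw [hg]; decide
/-- **`90b2` is multiplicative at `2`** (`2 ∣ Δ`, `2 ∤ c₄`). [cite: SilvermanAEC2009, VII.5 Prop. 5.1(b)] -/
theorem mult_two_90b2 : Mult c90b2 2 := by
  have hgen : Rat.HeightOneSpectrum.natGenerator
      ((Rat.HeightOneSpectrum.primesEquiv (R := ℤ)).symm ⟨2, Nat.prime_two⟩) = 2 :=
    Literature.NumberTheory.EllipticCurves.Rat.natGenerator_primesEquiv_symm ⟨2, Nat.prime_two⟩
  have hm : c90b2.HasMultiplicativeReductionAt
      ((Rat.HeightOneSpectrum.primesEquiv (R := ℤ)).symm ⟨2, Nat.prime_two⟩) := by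
    refine hasMultiplicativeReductionAt_of_valuation_c₄_eq_one (isIntegralAt_baseChange _ M90b2) ?_ ?_
    · rw [baseChange_int_c₄, Literature.NumberTheory.EllipticCurves.Rat.valuation_intCast_eq_one_iff, hgen,
        M90b2_c₄]; decide
    · rw [baseChange_int_Δ, Literature.NumberTheory.EllipticCurves.Rat.valuation_intCast_lt_one_iff, hgen,
        M90b2_Δ]; decide
  exact (hasMultiplicativeReductionAtPrime_iff_hasMultiplicativeReductionAt_holds c90b2
    ⟨2, Nat.prime_two⟩).mpr hm
/-- `90b2 mod 2`. [folklore] -/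
theorem M90b2_mod_two : M90b2.map (Int.castRingHom (ZMod 2)) = ⟨1, 1, 1, 0, 1⟩ := by
  ext <;> decide
/-- **`90b2` is SPLIT multiplicative at `2`** (the node quadratic has the root `0` in `𝔽₂`). [cite: SilvermanAEC2009, VII.5 Prop. 5.1(b)] -/
theorem split_two_90b2 : c90b2.HasSplitMultiplicativeReductionAtPrime 2 := by
  have hint : integralModelInt c90b2 = M90b2 := integralModelInt_baseChange_int M90b2
  have hΔ : ((2 : ℕ) : ℤ) ∣ (integralModelInt c90b2).Δ := by rw [hint, M90b2_Δ]; decide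
  have hc₄ : ¬ ((2 : ℕ) : ℤ) ∣ (integralModelInt c90b2).c₄ := by rw [hint, M90b2_c₄]; decide
  rw [LocalTorsionMult.hasSplitMultiplicativeReductionAtPrime_iff_splits_integralModelInt c90b2 2 hΔ
    hc₄, hint, M90b2_mod_two]
  dsimp only
  rw [sub_eq_add_neg, ← Polynomial.C_neg]
  exact splits_quadratic_F2_of_root (by decide) 0 (by decide)
/-- The conductor exponents of `90b2`: `1` at the multiplicative primes, `2` at the additive ones (at `3`: Rizzo's Table II; at `ℓ ≥ 5`: ATAEC IV.10.2), `0` else.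
[cite: Silverman1994, IV.10.2] [cite: Rizzo2003, Table II (p. 4), column v(N)] -/
theorem factorization_conductorNorm_90b2 (p : ℕ) (hp : p.Prime) :
    (c90b2.conductorNorm ℤ).factorization p = (90 : ℕ).factorization p := by
  have key : (c90b2.conductorNorm ℤ).factorization p =
      c90b2.conductorExponent ((Rat.HeightOneSpectrum.primesEquiv (R := ℤ)).symm ⟨p, hp⟩) :=
    factorization_conductorNorm_primesEquiv_symm c90b2 ⟨p, hp⟩
  rw [key, nfact_90b1]
  by_cases h2 : 2 = p
  · subst h2
    rw [conductorExponent_baseChange_int_eq_one M90b2 hp (by rw [M90b2_Δ]; decide)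
      (by rw [M90b2_c₄]; decide)]
    norm_num
  by_cases h3 : 3 = p
  · subst h3
    rw [show ((Rat.HeightOneSpectrum.primesEquiv (R := ℤ)).symm ⟨3, hp⟩) =
        (Rat.HeightOneSpectrum.primesEquiv (R := ℤ)).symm ⟨3, Nat.prime_three⟩ from rfl,
      conductorExponent_baseChange_int_three M90b2 condExp_90b2]
    norm_num
  by_cases h5 : 5 = p
  · subst h5
    rw [conductorExponent_baseChange_int_eq_one M90b2 hp (by rw [M90b2_Δ]; decide)
      (by rw [M90b2_c₄]; decide)]
    norm_num
  rw [if_neg h2, if_neg h3, if_neg h5]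
  refine conductorExponent_baseChange_int_eq_zero M90b2 hp fun hd ↦ ?_
  rw [M90b2_Δ, show (5400 : ℤ) = 2 ^ 3 * 3 ^ 3 * 5 ^ 2 by norm_num] at hd
  have hp' : Prime (p : ℤ) := Nat.prime_iff_prime_int.mp hp
  rcases hp'.dvd_or_dvd hd with hd | h_5; swap
  · exact h5 ((Nat.prime_dvd_prime_iff_eq hp (by norm_num : Nat.Prime 5)).mp (by exact_mod_cast hp'.dvd_of_dvd_pow h_5)).symm
  rcases hp'.dvd_or_dvd hd with hd | h_3; swap
  · exact h3 ((Nat.prime_dvd_prime_iff_eq hp (by norm_num : Nat.Prime 3)).mp (by exact_mod_cast hp'.dvd_of_dvd_pow h_3)).symm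
  exact h2 ((Nat.prime_dvd_prime_iff_eq hp (by norm_num : Nat.Prime 2)).mp (by exact_mod_cast hp'.dvd_of_dvd_pow hd)).symm

/-- **`N(90b2) = 90`.** [cite: CremonaAlgorithms1997, Table 1] -/
theorem conductorNorm_90b2 : c90b2.conductorNorm ℤ = 90 := by
  refine Nat.eq_of_factorization_eq (c90b2.conductorNorm_pos_holds).ne' (by norm_num) fun p ↦ ?_
  by_cases hp : p.Prime; · exact factorization_conductorNorm_90b2 p hp
  rw [Nat.factorization_eq_zero_of_not_prime _ hp, Nat.factorization_eq_zero_of_not_prime _ hp]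

/-- The coefficients of `90b2 / ℚ` (unfolded). [cite: CremonaAlgorithms1997, Table 1] -/
theorem c90b2_eq : c90b2 = ⟨1, -1, 1, -128, 587⟩ := by
  rw [c90b2, baseChange_int_eq]; norm_num
/-- `b₂, b₄, b₆` of `90b2`; `2`-division cubic `= (x − (27 / 4))(4x² + (24)x + ((-348)))`. [cite: SilvermanAEC2009, III.1] -/
theorem c90b2_b : c90b2.b₂ = -3 ∧ c90b2.b₄ = -255 ∧ c90b2.b₆ = 2349 := by
  rw [c90b2_eq]
  simp only [WeierstrassCurve.b₂, WeierstrassCurve.b₄, WeierstrassCurve.b₆]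
  norm_num
/-- The rational point `(27/4, -31/8)` of order `2` on `90b2`. [cite: CremonaAlgorithms1997, Table 1] -/
theorem c90b2_P : c90b2.toAffine.Equation (27 / 4) (-31 / 8) ∧
    2 * ((-31 / 8) : ℚ) + c90b2.a₁ * (27 / 4) + c90b2.a₃ = 0 := by
  rw [c90b2_eq, WeierstrassCurve.Affine.equation_iff]; norm_num
/-- **`(27/4, -31/8)` is the ONLY rational point of order `2` on `90b2`** (the cofactor `4x² + (24)x + ((-348))` has non-square discriminant). [cite: SilvermanAEC2009, III.2.3] -/
theorem c90b2_unique : HasUniqueRationalTwoTorsionX c90b2 (27 / 4) := by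
  refine ⟨⟨(-31 / 8), c90b2_P⟩, fun z hz ↦ ?_⟩
  have hc := cubic_eq_zero_of_hasRationalTwoTorsionX hz
  obtain ⟨hb₂, hb₄, hb₆⟩ := c90b2_b
  rw [hb₂, hb₄, hb₆] at hc
  have hfac : (z - (27 / 4)) * (4 * z ^ 2 + 24 * z + (-348)) = 0 := by linear_combination hc
  exact eq_of_cubic_factor_of_not_isSquare z hfac (by norm_num)
/-- `(27/4, ·)` is "ramified at `2`" (`v₂(x) = −2`). [cite: GreenbergLNM1716, §5 (chunk p0176)] -/
theorem c90b2_ram : TwoTorsionRamifiedAtTwo ((27 / 4) : ℚ) := by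
  have := twoTorsionRamifiedAtTwo_of_odd_div_four (27) (by decide)
  push_cast at this
  simpa [neg_div] using this
/-- `(27/4, ·)` is NOT "odd": `(−u − √(u² − 16v))/8 < 27/4` is a smaller real root of the `2`-division cubic (`u = 24`, `v = -348`).
[cite: GreenbergLNM1716, §5 Remark (chunk p0174)] -/
theorem c90b2_not_odd : ¬ TwoTorsionOdd c90b2 (27 / 4) := by
  intro hodd
  obtain ⟨hb₂, hb₄, hb₆⟩ := c90b2_b
  obtain ⟨r, hr, hlt⟩ := exists_cubic_root_lt (x₀ := ((27 / 4) : ℝ)) (u := 24) (v := (-348)) (by norm_num)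
    (lt_of_lt_of_le (by norm_num) (Real.sqrt_nonneg _))
  have := hodd r (by rw [hb₂, hb₄, hb₆]; push_cast; linear_combination hr)
  push_cast at this
  linarith
/-- **`(27/4, ·)` is of Greenberg type A** (ramified at `2`, not odd). [cite: GreenbergLNM1716, Prop. 5.14 (p. 171)] -/
theorem c90b2_typeAB : (TwoTorsionRamifiedAtTwo ((27 / 4) : ℚ) ∧ ¬ TwoTorsionOdd c90b2 (27 / 4)) ∨
    (TwoTorsionOdd c90b2 (27 / 4) ∧ ¬ TwoTorsionRamifiedAtTwo ((27 / 4) : ℚ)) :=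
  Or.inl ⟨c90b2_ram, c90b2_not_odd⟩

/-- `2 ∣ #Ẽ(𝔽_ℓ)` for `90b2` at every good odd prime `ℓ` (a rational `2`-torsion point). [cite: SilvermanAEC2009, VII.3.1(b)] -/
theorem two_dvd_reductionPointCount_90b2 {ℓ : ℕ} [Fact ℓ.Prime] (hℓ : 3 ≤ ℓ)
    (hΔ : ¬ (ℓ : ℤ) ∣ (5400 : ℤ)) : 2 ∣ c90b2.reductionPointCount ℓ :=
  two_dvd_reductionPointCount_of_hasRationalTwoTorsionX ⟨(-31 / 8), c90b2_P⟩ hℓ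
    (by rw [minimalDiscriminantInt_baseChange_int, M90b2_Δ]; exact hΔ)

/-! ## Anchor `42a4` (`N = 42`, split at `2`, type A, `x(P) = 83/4`) -/

/-- Cremona `42a4` = `[1, 1, 1, -1344, 18405]` (integer model). [cite: CremonaAlgorithms1997, Table 1] -/
abbrev M42a4 : WeierstrassCurve ℤ := ⟨1, 1, 1, -1344, 18405⟩
/-- `42a4 / ℚ`. [cite: CremonaAlgorithms1997, Table 1] -/
abbrev c42a4 : WeierstrassCurve ℚ := M42a4.baseChange ℚ
/-- `Δ(42a4) = 2^2·3^2·7`. [cite: CremonaAlgorithms1997, Table 1] -/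
theorem M42a4_Δ : M42a4.Δ = 252 := by decide
/-- `c₄(42a4)` (`|c₄| = 64513`). [cite: CremonaAlgorithms1997, Table 1] -/
theorem M42a4_c₄ : M42a4.c₄ = 64513 := by decide
/-- `42a4` is an elliptic curve. [cite: CremonaAlgorithms1997, Table 1] -/
instance c42a4_isElliptic : c42a4.IsElliptic := by
  rw [WeierstrassCurve.isElliptic_iff, baseChange_int_Δ, M42a4_Δ]; norm_num
/-- Cremona's model `42a4` is globally minimal (`gcd(Δ, c₄) = 1`). [cite: SilvermanAEC2009, VII.1 Remark 1.1] -/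
instance c42a4_isGloballyMinimal : c42a4.IsGloballyMinimal :=
  isGloballyMinimal_baseChange_int_of_gcd_eq_one 1 1 1 (-1344) 18405 (by decide)
/-- **`42a4` is multiplicative at `2`** (`2 ∣ Δ`, `2 ∤ c₄`). [cite: SilvermanAEC2009, VII.5 Prop. 5.1(b)] -/
theorem mult_two_42a4 : Mult c42a4 2 := by
  have hgen : Rat.HeightOneSpectrum.natGenerator
      ((Rat.HeightOneSpectrum.primesEquiv (R := ℤ)).symm ⟨2, Nat.prime_two⟩) = 2 :=
    Literature.NumberTheory.EllipticCurves.Rat.natGenerator_primesEquiv_symm ⟨2, Nat.prime_two⟩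
  have hm : c42a4.HasMultiplicativeReductionAt
      ((Rat.HeightOneSpectrum.primesEquiv (R := ℤ)).symm ⟨2, Nat.prime_two⟩) := by
    refine hasMultiplicativeReductionAt_of_valuation_c₄_eq_one (isIntegralAt_baseChange _ M42a4) ?_ ?_
    · rw [baseChange_int_c₄, Literature.NumberTheory.EllipticCurves.Rat.valuation_intCast_eq_one_iff, hgen,
        M42a4_c₄]; decide
    · rw [baseChange_int_Δ, Literature.NumberTheory.EllipticCurves.Rat.valuation_intCast_lt_one_iff, hgen,
        M42a4_Δ]; decide
  exact (hasMultiplicativeReductionAtPrime_iff_hasMultiplicativeReductionAt_holds c42a4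
    ⟨2, Nat.prime_two⟩).mpr hm
/-- `42a4 mod 2`. [folklore] -/
theorem M42a4_mod_two : M42a4.map (Int.castRingHom (ZMod 2)) = ⟨1, 1, 1, 0, 1⟩ := by
  ext <;> decide
/-- **`42a4` is SPLIT multiplicative at `2`** (the node quadratic has the root `0` in `𝔽₂`). [cite: SilvermanAEC2009, VII.5 Prop. 5.1(b)] -/
theorem split_two_42a4 : c42a4.HasSplitMultiplicativeReductionAtPrime 2 := by
  have hint : integralModelInt c42a4 = M42a4 := integralModelInt_baseChange_int M42a4
  have hΔ : ((2 : ℕ) : ℤ) ∣ (integralModelInt c42a4).Δ := by rw [hint, M42a4_Δ]; decide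
  have hc₄ : ¬ ((2 : ℕ) : ℤ) ∣ (integralModelInt c42a4).c₄ := by rw [hint, M42a4_c₄]; decide
  rw [LocalTorsionMult.hasSplitMultiplicativeReductionAtPrime_iff_splits_integralModelInt c42a4 2 hΔ
    hc₄, hint, M42a4_mod_two]
  dsimp only
  rw [sub_eq_add_neg, ← Polynomial.C_neg]
  exact splits_quadratic_F2_of_root (by decide) 0 (by decide)
/-- `Δ(42a4)`, `c₄(42a4)` coprime (semistable model). [cite: SilvermanAEC2009, VII.5 Prop. 5.1(b)] -/
theorem M42a4_coprime : IsCoprime M42a4.Δ M42a4.c₄ := by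
  rw [M42a4_Δ, M42a4_c₄, Int.isCoprime_iff_gcd_eq_one]; decide
/-- **The conductor of `42a4` is `42`** (semistable: the radical of `Δ`; Silverman ATAEC IV.10.2). [cite: CremonaAlgorithms1997, Table 1] [cite: Silverman1994, IV.10.2] -/
theorem conductorNorm_42a4 : c42a4.conductorNorm ℤ = 42 := by
  refine conductorNorm_baseChange_int_of_isCoprime M42a4 M42a4_coprime (k := 2) ?_ ?_ ?_
  · rw [Nat.squarefree_iff_nodup_primeFactorsList (by norm_num)]; simp
  · rw [M42a4_Δ]; decide
  · rw [M42a4_Δ]; decide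

/-- The coefficients of `42a4 / ℚ` (unfolded). [cite: CremonaAlgorithms1997, Table 1] -/
theorem c42a4_eq : c42a4 = ⟨1, 1, 1, -1344, 18405⟩ := by
  rw [c42a4, baseChange_int_eq]; norm_num
/-- `b₂, b₄, b₆` of `42a4`; `2`-division cubic `= (x − (83 / 4))(4x² + (88)x + ((-3548)))`. [cite: SilvermanAEC2009, III.1] -/
theorem c42a4_b : c42a4.b₂ = 5 ∧ c42a4.b₄ = -2687 ∧ c42a4.b₆ = 73621 := by
  rw [c42a4_eq]
  simp only [WeierstrassCurve.b₂, WeierstrassCurve.b₄, WeierstrassCurve.b₆]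
  norm_num
/-- The rational point `(83/4, -87/8)` of order `2` on `42a4`. [cite: CremonaAlgorithms1997, Table 1] -/
theorem c42a4_P : c42a4.toAffine.Equation (83 / 4) (-87 / 8) ∧
    2 * ((-87 / 8) : ℚ) + c42a4.a₁ * (83 / 4) + c42a4.a₃ = 0 := by
  rw [c42a4_eq, WeierstrassCurve.Affine.equation_iff]; norm_num
/-- **`(83/4, -87/8)` is the ONLY rational point of order `2` on `42a4`** (the cofactor `4x² + (88)x + ((-3548))` has non-square discriminant). [cite: SilvermanAEC2009, III.2.3] -/
theorem c42a4_unique : HasUniqueRationalTwoTorsionX c42a4 (83 / 4) := by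
  refine ⟨⟨(-87 / 8), c42a4_P⟩, fun z hz ↦ ?_⟩
  have hc := cubic_eq_zero_of_hasRationalTwoTorsionX hz
  obtain ⟨hb₂, hb₄, hb₆⟩ := c42a4_b
  rw [hb₂, hb₄, hb₆] at hc
  have hfac : (z - (83 / 4)) * (4 * z ^ 2 + 88 * z + (-3548)) = 0 := by linear_combination hc
  exact eq_of_cubic_factor_of_not_isSquare z hfac (by norm_num)
/-- `(83/4, ·)` is "ramified at `2`" (`v₂(x) = −2`). [cite: GreenbergLNM1716, §5 (chunk p0176)] -/
theorem c42a4_ram : TwoTorsionRamifiedAtTwo ((83 / 4) : ℚ) := by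
  have := twoTorsionRamifiedAtTwo_of_odd_div_four (83) (by decide)
  push_cast at this
  simpa [neg_div] using this
/-- `(83/4, ·)` is NOT "odd": `(−u − √(u² − 16v))/8 < 83/4` is a smaller real root of the `2`-division cubic (`u = 88`, `v = -3548`).
[cite: GreenbergLNM1716, §5 Remark (chunk p0174)] -/
theorem c42a4_not_odd : ¬ TwoTorsionOdd c42a4 (83 / 4) := by
  intro hodd
  obtain ⟨hb₂, hb₄, hb₆⟩ := c42a4_b
  obtain ⟨r, hr, hlt⟩ := exists_cubic_root_lt (x₀ := ((83 / 4) : ℝ)) (u := 88) (v := (-3548)) (by norm_num)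
    (lt_of_lt_of_le (by norm_num) (Real.sqrt_nonneg _))
  have := hodd r (by rw [hb₂, hb₄, hb₆]; push_cast; linear_combination hr)
  push_cast at this
  linarith
/-- **`(83/4, ·)` is of Greenberg type A** (ramified at `2`, not odd). [cite: GreenbergLNM1716, Prop. 5.14 (p. 171)] -/
theorem c42a4_typeAB : (TwoTorsionRamifiedAtTwo ((83 / 4) : ℚ) ∧ ¬ TwoTorsionOdd c42a4 (83 / 4)) ∨
    (TwoTorsionOdd c42a4 (83 / 4) ∧ ¬ TwoTorsionRamifiedAtTwo ((83 / 4) : ℚ)) :=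
  Or.inl ⟨c42a4_ram, c42a4_not_odd⟩

/-- `2 ∣ #Ẽ(𝔽_ℓ)` for `42a4` at every good odd prime `ℓ` (a rational `2`-torsion point). [cite: SilvermanAEC2009, VII.3.1(b)] -/
theorem two_dvd_reductionPointCount_42a4 {ℓ : ℕ} [Fact ℓ.Prime] (hℓ : 3 ≤ ℓ)
    (hΔ : ¬ (ℓ : ℤ) ∣ (252 : ℤ)) : 2 ∣ c42a4.reductionPointCount ℓ :=
  two_dvd_reductionPointCount_of_hasRationalTwoTorsionX ⟨(-87 / 8), c42a4_P⟩ hℓ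
    (by rw [minimalDiscriminantInt_baseChange_int, M42a4_Δ]; exact hΔ)

end Summit.BirchSwinnertonDyer.Rank1Residual.X5.Instances
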